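import Summits.ValiantsHypothesis.ValiantsHypothesis.Theorems.LacunarySymmetroidMatrixDescartesDoorA26WallBubblingFirstOrderDual

/-!
# `DoorA26` / line `wall_bubbling` — BALANCE COUNT: a balanced touch profile has at least SEVEN touches; the Q-lift for any ≤ 6 touches

HONEST FRAMING.  Object-search cell `pub-symmetroid`, crux `Theses.LacunarySymmetroid.DoorA26` (stmt-ValiantsHypothesis-19979; OPEN, typed,
never asserted).  W2 seat val-sym-door-p1 g18, file #48; def-free helper for obligation (R) of `Cruxes/DoorA26/Lines/wall_bubbling.lean`, continuing
#46 `…SignWord` (Q-lift, total positivity `det_exp_ne_zero`, sign-word lemma) and #47 `…FirstOrderDual` (`mem_twentyLocus_of_touches_noBalance`: a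
touch profile lifts to a twenty unless it is BALANCED — weights `μ ≥ 0` on the touch set `J`, not all zero, with `Σ_j μ_j κ_j e^{δ_l τ_j} P(τ_j) = 0`
for all six `l`).

WHAT IS HERE.  `eq_zero_of_expEval_combination_eq_zero`: the point evaluations of the `K`-term real exponential Chebyshev system at `≤ K` distinct nodes
are LINEARLY INDEPENDENT (a vector supported on `≤ K` abscissae and orthogonal to all `K` exponentials vanishes — square subsystem on the first `|J|`
exponents and `det_exp_ne_zero`); `eq_zero_of_expEval_combination_signWord`: DISCRETE CHEBYSHEV ALTERNATION (a kernel vector of point evaluations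
whose sign pattern is cut out by `< K` change points vanishes — pair with the sign-word function); ★ `seven_le_card_of_balance`: a balance with some
`μ_j ≠ 0` and `κ_j ≠ 0 ≠ tr P(τ_j)` on `J` forces `7 ≤ |J|` (entry by entry the vectors `(μ_j κ_j P(τ_j)_{ab})_j` are kernel vectors of `≤ 6` point
evaluations); ★ `mem_twentyLocus_of_touches_card_le_six`: strictly increasing exponents and abscissae, alternating `κ`, ANY touch set of at most six
abscissae (`det P = 0 ≠ tr P` there, `0 < κ det P` elsewhere) ⇒ `δ ∈ TwentyLocus` — #45's designated injection `e : Fin 6 ↪ Fin 21` is no longer needed.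
READING for (R): with #46–#48 the rank-one multiplicity residual is «balanced profiles with 7 ≤ |J| ≤ 10 touches» (and, by the alternation lemma, each
non-zero balance column changes sign ≥ 6 times along the touches); nothing here bears on `DoorA26`, `DoorA34`, (W)/(M)/(R), `MatrixDescartes` (18050) or
`VP ≠ VNP`; registers unchanged.

[folklore] Chebyshev/Haar property of real exponentials (linear algebra on `det_exp_ne_zero`); [this work] the packaging.
-/

-- `Summit.ValiantsHypothesis.ValiantsHypothesis.…` repeats a component by the D-0017 layout
-- (single-conjunct summit), which the `dupNamespace` linter flags; the name is mandated.
set_option linter.dupNamespace false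

namespace Summit.ValiantsHypothesis.ValiantsHypothesis.Theorems.LacunarySymmetroidMatrixDescartes.WallBubbling

open Finset Filter Topology
open Bubbling (TwentyLocus)

/-- **Point evaluations of the `K`-term exponential Chebyshev system at `≤ K` distinct nodes are linearly independent**: if `a` is supported on a set `J`
of at most `K` abscissae (strictly increasing `τ`, strictly increasing exponents) and `Σ_j a_j e^{δ_l τ_j} = 0` for every `l`, then `a = 0`.  (Square
subsystem on the first `|J|` exponents + `det_exp_ne_zero`.) [folklore] -/
theorem eq_zero_of_expEval_combination_eq_zero {K N : ℕ} (δ : Fin K → ℝ) (hd : StrictMono δ) (τ : Fin N → ℝ) (hτ : StrictMono τ)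
    (J : Finset (Fin N)) (hJ : J.card ≤ K) (a : Fin N → ℝ) (haJ : ∀ j ∉ J, a j = 0)
    (ha : ∀ l, ∑ j, a j * Real.exp (δ l * τ j) = 0) : ∀ j, a j = 0 := by
  classical
  set k := J.card with hk
  -- enumerate `J` increasingly and restrict to the first `k` exponents
  let e : Fin k → Fin N := fun i => J.orderEmbOfFin rfl i
  have he_mem : ∀ i, e i ∈ J := fun i => J.orderEmbOfFin_mem rfl i
  have he_inj : Function.Injective e := (J.orderEmbOfFin rfl).injective
  let ι : Fin k → Fin K := Fin.castLE hJ
  have hι : Function.Injective (δ ∘ ι) := (hd.comp (Fin.strictMono_castLE hJ)).injective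
  have hv : Function.Injective (fun i => τ (e i)) := hτ.injective.comp he_inj
  have hdet := det_exp_ne_zero (δ ∘ ι) (fun i => τ (e i)) hι hv
  -- the vector `i ↦ a (e i)` is a left kernel vector of the square matrix
  set A : Matrix (Fin k) (Fin k) ℝ := Matrix.of fun l m => Real.exp ((δ ∘ ι) l * τ (e m)) with hA
  have hker : Matrix.vecMul (fun i => a (e i)) A.transpose = 0 := by
    funext l
    simp only [Matrix.vecMul, dotProduct, Matrix.transpose_apply, Matrix.of_apply, Pi.zero_apply, A]
    -- `Σ_i a(e i) e^{δ_{ι l} τ_{e i}} = Σ_j a_j e^{δ_{ι l} τ_j} = 0`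
    have h := ha (ι l)
    rw [← Finset.sum_subset (Finset.subset_univ J) (fun j _ hj => by rw [haJ j hj, zero_mul])] at h
    rw [← h, ← Finset.sum_coe_sort J]
    -- reindex `J` by `e`
    have : ∑ i : Fin k, a (e i) * Real.exp ((δ ∘ ι) l * τ (e i))
        = ∑ j : J, a j * Real.exp (δ (ι l) * τ j) := by
      refine Fintype.sum_equiv ((J.orderIsoOfFin rfl).toEquiv) _ _ fun i => ?_
      rfl
    simpa [Function.comp] using this
  by_contra hne
  push Not at hne
  obtain ⟨j0, hj0⟩ := hne
  have hj0J : j0 ∈ J := by by_contra h; exact hj0 (haJ j0 h)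
  -- so the kernel vector is nonzero, contradicting `det Aᵀ ≠ 0`
  have hvec : (fun i => a (e i)) ≠ 0 := by
    intro h0
    obtain ⟨i, hi⟩ : ∃ i, e i = j0 := by
      have : j0 ∈ Set.range e := by
        rw [show Set.range e = (J : Set (Fin N)) from by
          ext x; constructor
          · rintro ⟨i, rfl⟩; exact he_mem i
          · intro hx
            refine ⟨(J.orderIsoOfFin rfl).symm ⟨x, hx⟩, ?_⟩
            show (J.orderEmbOfFin rfl) ((J.orderIsoOfFin rfl).symm ⟨x, hx⟩) = x
            rw [← Finset.coe_orderIsoOfFin_apply, OrderIso.apply_symm_apply]]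
        exact hj0J
      exact this
    have := congrFun h0 i
    rw [hi] at this
    exact hj0 this
  have := Matrix.exists_vecMul_eq_zero_iff.1 ⟨_, hvec, hker⟩
  rw [Matrix.det_transpose] at this
  exact hdet this


/-- **Discrete Chebyshev alternation.**  A kernel vector of the point evaluations (`Σ_j a_j e^{δ_l τ_j} = 0` for every `l`, `a` supported on `J`) whose sign
pattern along `J` is cut out by `q < K` change points (`0 ≤ a_j·∏_i (u_i − τ_j)`, `τ_j ∉ u`) vanishes: pair with the sign-word function of #46. [folklore] -/
theorem eq_zero_of_expEval_combination_signWord {K N q : ℕ} (δ : Fin K → ℝ) (hd : StrictMono δ) (hq : q < K) (u : Fin q → ℝ)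
    (hu : StrictMono u) (τ : Fin N → ℝ) (J : Finset (Fin N)) (a : Fin N → ℝ) (haJ : ∀ j ∉ J, a j = 0)
    (hsign : ∀ j ∈ J, (∀ i, τ j ≠ u i) ∧ 0 ≤ a j * ∏ i, (u i - τ j))
    (ha : ∀ l, ∑ j, a j * Real.exp (δ l * τ j) = 0) : ∀ j, a j = 0 := by
  classical
  obtain ⟨c, hc⟩ := exists_expSum_signWord δ hd hq u hu
  have hsum : ∑ j, a j * (∑ l, c l * Real.exp (δ l * τ j)) = 0 := by
    calc ∑ j, a j * (∑ l, c l * Real.exp (δ l * τ j))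
        = ∑ j, ∑ l, c l * (a j * Real.exp (δ l * τ j)) := by
          refine Finset.sum_congr rfl fun j _ => ?_
          rw [Finset.mul_sum]; refine Finset.sum_congr rfl fun l _ => ?_; ring
      _ = ∑ l, ∑ j, c l * (a j * Real.exp (δ l * τ j)) := Finset.sum_comm
      _ = ∑ l, c l * ∑ j, a j * Real.exp (δ l * τ j) := by
          refine Finset.sum_congr rfl fun l _ => ?_; rw [Finset.mul_sum]
      _ = 0 := Finset.sum_eq_zero fun l _ => by rw [ha l, mul_zero]
  have hnn : ∀ j, 0 ≤ a j * (∑ l, c l * Real.exp (δ l * τ j)) := by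
    intro j
    by_cases hj : j ∈ J
    · obtain ⟨hne, hs⟩ := hsign j hj
      have hφ := hc (τ j) hne
      have hP2 : 0 < (∏ i, (u i - τ j)) ^ 2 := by
        have : (∏ i, (u i - τ j)) ≠ 0 := Finset.prod_ne_zero_iff.2 fun i _ => sub_ne_zero.2 (hne i).symm
        positivity
      have h := mul_nonneg hs hφ.le
      have hre : a j * (∏ i, (u i - τ j)) * ((∏ i, (u i - τ j)) * ∑ l, c l * Real.exp (δ l * τ j))
          = (a j * ∑ l, c l * Real.exp (δ l * τ j)) * (∏ i, (u i - τ j)) ^ 2 := by ring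
      rw [hre] at h
      exact (mul_nonneg_iff_of_pos_right hP2).1 h
    · rw [haJ j hj, zero_mul]
  have hz := (Finset.sum_eq_zero_iff_of_nonneg (fun j _ => hnn j)).1 hsum
  intro j
  by_cases hj : j ∈ J
  · obtain ⟨hne, hs⟩ := hsign j hj
    have hφ := hc (τ j) hne
    have hφne : (∑ l, c l * Real.exp (δ l * τ j)) ≠ 0 := by
      intro h0; rw [h0, mul_zero] at hφ; exact lt_irrefl _ hφ
    rcases mul_eq_zero.1 (hz j (Finset.mem_univ j)) with h | h
    · exact h
    · exact absurd h hφne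
  · exact haJ j hj

/-- **A balance needs at least seven touches.**  If `μ` is supported on `J`, some `μ_j ≠ 0`, every touch has `κ_j ≠ 0 ≠ tr P(τ_j)`, and the six matrix
balance equations hold, then `7 ≤ |J|` (exponents and abscissae strictly increasing).  Entry by entry the vectors `(μ_j κ_j P(τ_j)_{ab})_j` are kernel
vectors of `≤ 6` point evaluations, hence zero by `eq_zero_of_expEval_combination_eq_zero`. [this work] -/
theorem seven_le_card_of_balance (δ : Fin 6 → ℝ) (hd : StrictMono δ) (S : Fin 6 → Matrix (Fin 2) (Fin 2) ℝ)
    (τ : Fin 21 → ℝ) (hτ : StrictMono τ) (κ : Fin 21 → ℝ) (J : Finset (Fin 21))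
    (hon : ∀ j ∈ J, κ j ≠ 0 ∧ (∑ l, Real.exp (δ l * τ j) • S l).trace ≠ 0)
    (μ : Fin 21 → ℝ) (hμJ : ∀ j ∉ J, μ j = 0) (hμne : ∃ j, μ j ≠ 0)
    (hμ : ∀ l, ∑ j, (μ j * κ j * Real.exp (δ l * τ j)) • (∑ l', Real.exp (δ l' * τ j) • S l') = 0) :
    7 ≤ J.card := by
  classical
  by_contra hlt
  have hJ : J.card ≤ 6 := by omega
  set P : Fin 21 → Matrix (Fin 2) (Fin 2) ℝ := fun j => ∑ l', Real.exp (δ l' * τ j) • S l' with hP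
  have hent : ∀ a b : Fin 2, ∀ j, μ j * κ j * (P j) a b = 0 := by
    intro a b
    refine eq_zero_of_expEval_combination_eq_zero δ hd τ hτ J hJ (fun j => μ j * κ j * (P j) a b)
      (fun j hj => by rw [hμJ j hj]; ring) (fun l => ?_)
    have h := congrFun (congrFun (hμ l) a) b
    rw [Matrix.sum_apply, Matrix.zero_apply] at h
    rw [← h]
    refine Finset.sum_congr rfl fun j _ => ?_
    rw [Matrix.smul_apply, smul_eq_mul]; ring
  obtain ⟨j0, hj0⟩ := hμne
  have hj0J : j0 ∈ J := by by_contra h; exact hj0 (hμJ j0 h)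
  obtain ⟨hk, htr⟩ := hon j0 hj0J
  have h00 := hent 0 0 j0
  have h11 := hent 1 1 j0
  have hsum : μ j0 * κ j0 * (P j0).trace = 0 := by
    rw [Matrix.trace_fin_two]; linear_combination h00 + h11
  rcases mul_eq_zero.1 hsum with h | h
  · rcases mul_eq_zero.1 h with h' | h'
    · exact hj0 h'
    · exact hk h'
  · exact htr h

/-- **THE Q-LIFT FOR AT MOST SIX TOUCHES, no designated injection** (strengthens #45): strictly increasing exponents and abscissae, alternating `κ`, a touch
set `J` with `|J| ≤ 6`, off `J` `0 < κ_j det P(τ_j)`, on `J` `det P(τ_j) = 0 ≠ tr P(τ_j)` ⇒ `δ ∈ TwentyLocus` (no balance by `seven_le_card_of_balance`,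
then `mem_twentyLocus_of_touches_noBalance`). [this work] -/
theorem mem_twentyLocus_of_touches_card_le_six (δ : Fin 6 → ℝ) (hd : StrictMono δ) (S : Fin 6 → Matrix (Fin 2) (Fin 2) ℝ)
    (hS : ∀ l, (S l).IsSymm) (τ : Fin 21 → ℝ) (hτ : StrictMono τ) (κ : Fin 21 → ℝ) (J : Finset (Fin 21)) (hJ : J.card ≤ 6)
    (hoff : ∀ j ∉ J, 0 < κ j * (∑ l, Real.exp (δ l * τ j) • S l).det)
    (hon : ∀ j ∈ J, (∑ l, Real.exp (δ l * τ j) • S l).det = 0 ∧ (∑ l, Real.exp (δ l * τ j) • S l).trace ≠ 0)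
    (halt : ∀ j : Fin 20, κ j.castSucc * κ j.succ < 0) :
    δ ∈ TwentyLocus := by
  classical
  have hκ : ∀ j, κ j ≠ 0 := by
    intro j hz
    rcases Fin.eq_castSucc_or_eq_last j with ⟨m, hm⟩ | hlast
    · have := halt m; rw [← hm, hz, zero_mul] at this; exact lt_irrefl _ this
    · have := halt (Fin.last 19); rw [Fin.succ_last, ← hlast, hz, mul_zero] at this; exact lt_irrefl _ this
  refine mem_twentyLocus_of_touches_noBalance δ S hS τ hτ κ J hoff (fun j hj => (hon j hj).1) ?_ halt
  intro μ _ hμJ hμ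
  by_contra hne
  push Not at hne
  have h7 := seven_le_card_of_balance δ hd S τ hτ κ J (fun j hj => ⟨hκ j, (hon j hj).2⟩) μ hμJ hne hμ
  omega

end Summit.ValiantsHypothesis.ValiantsHypothesis.Theorems.LacunarySymmetroidMatrixDescartes.WallBubbling
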